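import Literature.Probability.LatticeModels.KCTwoPointSourceMag
import HarnessLib

/-!
# The renormalised two-point family is a nice family

Topic `Literature/Probability/LatticeModels`. The two-point Kadanoff–Ceva family
(`KCTwoPointFamily.lean`) with its primitive shifted by the frozen boundary value `c_δ`
(`frozenVal`) and normalised by `N_δ = S₀(δ)² + 𝓜_δ(R₀(δ))` (`twoPointNorm`, with
`S₀(δ) = 𝔼⁺[σ_{v₀} σ_{b̂}] > 0`, `KCTwoPointSourceMag.lean`) satisfies the standing hypotheses
`KCSectionFamily.IsNiceCore` off `{a, b}` (Chelkak–Hongler–Izyurov 2015, §3.3–3.4: the a priori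
bound of `KCTwoPointSupBound.apriori_bound` is its clause `hbound`), and the four row gauges are
gauges of it over the four charts; moreover the shifted primitive is `η N_δ`-small on a boundary
collar for every `η > 0` (op. cit. (3.15) via `boundary_smallness_mesh`).

* `twoPointFamilyS` — the shifted family `(H° - c_δ, H• - c_δ)`;
* `isNiceCore_twoPointFamilyS`, `isGauge_twoPointFamilyS`;
* `eventually_collar_eta` — two-sided white / one-sided black collar smallness at level `η N_δ`.

Everything is proved; no named fact.

## References

* D. Chelkak, C. Hongler, K. Izyurov, Ann. of Math. 181 (2015), §3.3–3.4, Thm 3.13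
  [ChelkakHonglerIzyurovAnnals2015].
-/

noncomputable section

namespace Literature.Probability.LatticeModels

open Complex Filter Metric Set _root_.Topology Finset SimpleGraph WeakBeurling
open scoped symmDiff

variable {Ω : Set ℂ} {a b : ℂ}

/-! ### Shifting a primitive by a constant -/

/-- A primitive of the flux form stays one after subtracting a constant. [cite: ChelkakHonglerIzyurovAnnals2015, Prop. 3.6] -/
theorem IsKCPrimitive.sub_const {G₂ : SimpleGraph (Site 2)} [G₂.LocallyFinite] {Λ : Finset (Site 2)} {β : ℝ}
    {bc : BoundaryCondition (Site 2)} {B : Finset (Site 2)} {cut : Site 2 → Finset (Sym2 (Site 2))} {Hw Hb : Site 2 → ℝ}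
    {P : Set (Site 2)} (h : IsKCPrimitive G₂ Λ β bc B cut Hw Hb P) (c : ℝ) :
    IsKCPrimitive G₂ Λ β bc B cut (fun y => Hw y - c) (fun y => Hb y - c) P := by
  intro q hq
  rw [← h q hq]
  ring

/-! ### The shifted family -/

variable (Ω a b) in
/-- **The renormalised two-point family**: the two-point family with primitive `(H° - c_δ, H• - c_δ)`.
[cite: ChelkakHonglerIzyurovAnnals2015, §3.4] -/
def twoPointFamilyS : KCSectionFamily where
  Λ := fun δ => compVol Ω a δ
  P := fun δ => ↑(fillFinset (touchPlaquettes (compVol Ω a δ)))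
  cut := (twoPointFamily Ω a b).cut
  Hw := fun δ y => (twoPointFamily Ω a b).Hw δ y - frozenVal Ω a b δ
  Hb := fun δ y => (twoPointFamily Ω a b).Hb δ y - frozenVal Ω a b δ
  B := fun δ => {nearestSite δ b}

/-- Unfolding the fields of the shifted family. [folklore] -/
@[simp] theorem twoPointFamilyS_Λ (δ : ℝ) : (twoPointFamilyS Ω a b).Λ δ = compVol Ω a δ := rfl
/-- Unfolding the fields of the shifted family. [folklore] -/
@[simp] theorem twoPointFamilyS_P (δ : ℝ) : (twoPointFamilyS Ω a b).P δ = ↑(fillFinset (touchPlaquettes (compVol Ω a δ))) := rfl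
/-- Unfolding the fields of the shifted family. [folklore] -/
@[simp] theorem twoPointFamilyS_cut : (twoPointFamilyS Ω a b).cut = (twoPointFamily Ω a b).cut := rfl
/-- Unfolding the fields of the shifted family. [folklore] -/
@[simp] theorem twoPointFamilyS_B (δ : ℝ) : (twoPointFamilyS Ω a b).B δ = {nearestSite δ b} := rfl
/-- Unfolding the fields of the shifted family. [folklore] -/
@[simp] theorem twoPointFamilyS_Hw (δ : ℝ) (y : Site 2) :
    (twoPointFamilyS Ω a b).Hw δ y = (twoPointFamily Ω a b).Hw δ y - frozenVal Ω a b δ := rfl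
/-- Unfolding the fields of the shifted family. [folklore] -/
@[simp] theorem twoPointFamilyS_Hb (δ : ℝ) (y : Site 2) :
    (twoPointFamilyS Ω a b).Hb δ y = (twoPointFamily Ω a b).Hb δ y - frozenVal Ω a b δ := rfl
/-- The shifted family has the same sections as the two-point family. [folklore] -/
theorem twoPointFamilyS_obs (δ : ℝ) : (twoPointFamilyS Ω a b).obs Ω δ = (twoPointFamily Ω a b).obs Ω δ := rfl

/-! ### Positivity of the normaliser -/

/-- `N_δ ≥ S₀(δ)² > 0`. [cite: ChelkakHonglerIzyurovAnnals2015, §3.4] -/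
theorem twoPointNorm_pos_of {δ : ℝ} (hS : 0 < srcMag0 Ω a b δ) (ε₀ : ℝ) : 0 < twoPointNorm Ω a b ε₀ δ := by
  have := supDev_nonneg (Ω := Ω) (a := a) (b := b) (δ := δ) (refRadius ε₀ δ)
  have h2 : 0 < srcMag0 Ω a b δ ^ 2 := by positivity
  rw [twoPointNorm]; linarith

/-- **`N_δ > 0` eventually.** [cite: ChelkakHonglerIzyurovAnnals2015, §3.4] -/
theorem eventually_twoPointNorm_pos (hΩo : IsOpen Ω) (hΩc : IsConnected Ω) (hM : MeshApproximates Ω) (ha : a ∈ Ω) (hb : b ∈ Ω)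
    (hHF : ∀ᶠ δ in 𝓝[>] (0 : ℝ), HoleFree (↑(meshInteriorFinset Ω δ) : Set (Site 2))) (ε₀ : ℝ) :
    ∀ᶠ δ in 𝓝[>] (0 : ℝ), 0 < twoPointNorm Ω a b ε₀ δ :=
  (eventually_srcMag0_pos hΩo hΩc hM ha hb hHF).mono fun _ h => twoPointNorm_pos_of h ε₀

/-- `S₀(δ) ≠ 0` eventually (the hypothesis `hS` of `apriori_bound`). [cite: ChelkakHonglerIzyurovAnnals2015, §3.4] -/
theorem eventually_srcMag0_ne_zero (hΩo : IsOpen Ω) (hΩc : IsConnected Ω) (hM : MeshApproximates Ω) (ha : a ∈ Ω) (hb : b ∈ Ω)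
    (hHF : ∀ᶠ δ in 𝓝[>] (0 : ℝ), HoleFree (↑(meshInteriorFinset Ω δ) : Set (Site 2))) :
    ∀ᶠ δ in 𝓝[>] (0 : ℝ), srcMag0 Ω a b δ ≠ 0 :=
  (eventually_srcMag0_pos hΩo hΩc hM ha hb hHF).mono fun _ h => h.ne'

/-! ### The shifted family is nice -/

/-- Sites read in a compact subset of `Ω ∖ {a, b}` are eventually free sites of the component volume
(and hence touching plaquettes). [cite: ChelkakHonglerIzyurovAnnals2015, §3.3] -/
theorem eventually_mem_compVol_of_compact (hΩo : IsOpen Ω) (hΩc : IsConnected Ω) (hM : MeshApproximates Ω) (ha : a ∈ Ω)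
    (hHF : ∀ᶠ δ in 𝓝[>] (0 : ℝ), HoleFree (↑(meshInteriorFinset Ω δ) : Set (Site 2))) (b : ℂ)
    {K : Set ℂ} (hKU : K ⊆ Ω \ {a, b}) (hK : IsCompact K) :
    ∀ᶠ δ in 𝓝[>] (0 : ℝ), ∀ y : Site 2, meshPoint δ y ∈ K → y ∈ compVol Ω a δ ∧ y ∈ touchPlaquettes (compVol Ω a δ) := by
  obtain ⟨ρ, hρ, h⟩ := twoPointFamily_bulk hΩo hΩc hM ha hHF b hKU hK
  filter_upwards [h] with δ h y hy
  have hyΛ : y ∈ compVol Ω a δ := (h y y hy (by rw [_root_.dist_self]; exact hρ.le)).1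
  have h0 : faceAt y 0 = y := by ext i; simp [faceAt]
  exact ⟨hyΛ, by simpa [h0] using faceAt_mem_touchPlaquettes hyΛ 0⟩

/-- **The renormalised two-point family is a nice family off `{a, b}`** with normaliser
`N_δ = S₀(δ)² + 𝓜_δ(R₀(δ))`, for every small reference scale `ε₀`. [cite: ChelkakHonglerIzyurovAnnals2015, §3.3–3.4 (Lemma 3.10, (3.16))] -/
theorem isNiceCore_twoPointFamilyS (hΩo : IsOpen Ω) (hΩc : IsConnected Ω) (hΩb : Bornology.IsBounded Ω) (hM : MeshApproximates Ω)
    (ha : a ∈ Ω) (hb : b ∈ Ω) (hab : a ≠ b) (hHF : ∀ᶠ δ in 𝓝[>] (0 : ℝ), HoleFree (↑(meshInteriorFinset Ω δ) : Set (Site 2))) :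
    ∃ εmax > 0, 8 * εmax ≤ infDist a Ωᶜ ∧ 8 * εmax ≤ infDist b Ωᶜ ∧ ∀ ε₀ : ℝ, 0 < ε₀ → ε₀ ≤ εmax →
      (twoPointFamilyS Ω a b).IsNiceCore Ω {a, b} (twoPointNorm Ω a b ε₀) := by
  obtain ⟨εmax, hεmax, hεa, hεb, hAB⟩ :=
    apriori_bound hΩo hΩc hΩb hM ha hb hab hHF (eventually_srcMag0_ne_zero hΩo hΩc hM ha hb hHF)
  refine ⟨εmax, hεmax, hεa, hεb, fun ε₀ hε₀ hle => ?_⟩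
  exact
    { adj := Eventually.of_forall fun _ v hv k => compVol_adj hv k
      cuts := by
        filter_upwards [eventually_goodScale hΩo hM ha hHF] with δ hδ
        exact (twoPointData_spec b hδ).1
      prim := by
        filter_upwards [eventually_goodScale hΩo hM ha hHF] with δ hδ
        exact (twoPointData_spec b hδ).2.2.2.1.sub_const _
      pos := eventually_twoPointNorm_pos hΩo hΩc hM ha hb hHF ε₀
      bulk := fun K hKU hK => twoPointFamily_bulk hΩo hΩc hM ha hHF b hKU hK
      hbound := by
        intro K hKU hK
        obtain ⟨C, hC, hbd⟩ := hAB ε₀ hε₀ hle K hKU hK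
        refine ⟨C, hC, ?_⟩
        filter_upwards [hbd, eventually_mem_compVol_of_compact hΩo hΩc hM ha hHF b hKU hK] with δ hbd hmem y hy
        exact ⟨(hbd y hy).1 (hmem y hy).1, (hbd y hy).2 (hmem y hy).2⟩ }

/-- **Each of the four row gauges is a gauge of the renormalised family over its chart.** [cite: ChelkakHonglerIzyurovAnnals2015, Prop. 2.4 and §3.2] -/
theorem isGauge_twoPointFamilyS (hΩo : IsOpen Ω) (hΩc : IsConnected Ω) (hM : MeshApproximates Ω) (ha : a ∈ Ω)
    (hHF : ∀ᶠ δ in 𝓝[>] (0 : ℝ), HoleFree (↑(meshInteriorFinset Ω δ) : Set (Site 2))) (b : ℂ) (s t : Bool) :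
    (twoPointFamilyS Ω a b).IsGauge (twoPointChart Ω a b s t) (twoPointGauge a b s t) :=
  ⟨(isGauge_twoPointFamily hΩo hΩc hM ha hHF b s t).pm, (isGauge_twoPointFamily hΩo hΩc hM ha hHF b s t).sgn⟩

/-! ### Collar smallness at level `η N_δ` -/

/-- **On a boundary collar the renormalised primitive is `η N_δ`-small** (white: two-sided; black:
from above), for every `η > 0`. [cite: ChelkakHonglerIzyurovAnnals2015, Thm 3.13 and (3.15)] -/
theorem eventually_collar_eta (hΩo : IsOpen Ω) (hΩb : Bornology.IsBounded Ω) (hM : MeshApproximates Ω)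
    (ha : a ∈ Ω) (hHF : ∀ᶠ δ in 𝓝[>] (0 : ℝ), HoleFree (↑(meshInteriorFinset Ω δ) : Set (Site 2)))
    {ε₀ : ℝ} (hN : ∀ᶠ δ in 𝓝[>] (0 : ℝ), 0 < twoPointNorm Ω a b ε₀ δ)
    (hε₀ : 0 < ε₀) (hε₀a : 8 * ε₀ ≤ infDist a Ωᶜ) (hε₀b : 8 * ε₀ ≤ infDist b Ωᶜ) {η : ℝ} (hη : 0 < η) :
    ∃ d > 0, ∀ᶠ δ in 𝓝[>] (0 : ℝ),
      (∀ v ∈ compVol Ω a δ, infDist (meshPoint δ v) Ωᶜ ≤ d →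
        |(twoPointFamily Ω a b).Hw δ v - frozenVal Ω a b δ| ≤ η * twoPointNorm Ω a b ε₀ δ) ∧
      (∀ f ∈ touchPlaquettes (compVol Ω a δ), infDist (meshPoint δ f) Ωᶜ ≤ d →
        (twoPointFamily Ω a b).Hb δ f ≤ frozenVal Ω a b δ + η * twoPointNorm Ω a b ε₀ δ) := by
  have hΩuniv : Ω ≠ Set.univ := fun h => by
    have := hΩb; rw [h] at this; exact NormedSpace.unbounded_univ ℝ ℂ this
  have hΩc' : Ωᶜ.Nonempty := Set.nonempty_compl.2 hΩuniv
  set 𝓕 := twoPointFamily Ω a b with h𝓕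
  have hadj : ∀ᶠ δ in 𝓝[>] (0 : ℝ), ∀ v ∈ 𝓕.Λ δ, ∀ k : Fin 4, (discreteDomainGraph Ω δ).Adj v (v + cornerUnit k) :=
    Eventually.of_forall fun _ v hv k => compVol_adj hv k
  have hΛsub : ∀ᶠ δ in 𝓝[>] (0 : ℝ), 𝓕.Λ δ ⊆ meshInteriorFinset Ω δ := Eventually.of_forall fun _ => compVol_subset
  have hδε : ∀ᶠ δ in 𝓝[>] (0 : ℝ), 2 * δ ≤ ε₀ := by
    have : ∀ᶠ δ in 𝓝[>] (0 : ℝ), δ ≤ ε₀ / 2 := mem_nhdsWithin_of_mem_nhds (Iic_mem_nhds (by positivity))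
    exact this.mono fun δ h => by linarith
  have hfar : ∀ᶠ δ in 𝓝[>] (0 : ℝ), (∀ b' ∈ 𝓕.B δ, 2 * ε₀ ≤ infDist (meshPoint δ b') Ωᶜ) ∧
      2 * ε₀ ≤ infDist (meshPoint δ (sourcePlaq δ a)) Ωᶜ := by
    filter_upwards [hδε, self_mem_nhdsWithin] with δ hδε hδ0
    have hδ0 : (0 : ℝ) < δ := hδ0
    constructor
    · intro b' hb'
      rw [show 𝓕.B δ = {nearestSite δ b} from rfl, Finset.mem_singleton] at hb'
      subst hb'
      have h1 := dist_meshPoint_nearestSite_le hδ0 b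
      have h2 := Metric.infDist_le_infDist_add_dist (s := Ωᶜ) (x := b) (y := meshPoint δ (nearestSite δ b))
      rw [_root_.dist_comm] at h2
      linarith
    · have h1 : dist (meshPoint δ (sourcePlaq δ a)) a ≤ 3 * δ :=
        (dist_triangle _ (meshPoint δ (nearestSite δ a)) _).trans (by
          linarith [dist_meshPoint_sourcePlaq_le hδ0.le a, dist_meshPoint_nearestSite_le hδ0 a])
      have h2 := Metric.infDist_le_infDist_add_dist (s := Ωᶜ) (x := a) (y := meshPoint δ (sourcePlaq δ a))
      rw [_root_.dist_comm] at h2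
      linarith
  have hapriori : ∀ᶠ δ in 𝓝[>] (0 : ℝ), ∀ y : Site 2, infDist (meshPoint δ y) Ωᶜ ≤ ε₀ →
      (y ∈ 𝓕.Λ δ → |𝓕.Hw δ y - frozenVal Ω a b δ| ≤ 1 * twoPointNorm Ω a b ε₀ δ) ∧
      (y ∈ touchPlaquettes (𝓕.Λ δ) → |𝓕.Hb δ y - frozenVal Ω a b δ| ≤ 1 * twoPointNorm Ω a b ε₀ δ) := by
    filter_upwards [hδε, self_mem_nhdsWithin] with δ hδε hδ0 y hy
    have hδ0 : (0 : ℝ) < δ := hδ0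
    have hpa : dist (meshPoint δ (sourcePlaq δ a)) a ≤ 3 * δ :=
      (dist_triangle _ (meshPoint δ (nearestSite δ a)) _).trans (by
        linarith [dist_meshPoint_sourcePlaq_le hδ0.le a, dist_meshPoint_nearestSite_le hδ0 a])
    have hpb : dist (meshPoint δ (nearestSite δ b)) b ≤ 3 * δ := by linarith [dist_meshPoint_nearestSite_le hδ0 b]
    have hya := not_mem_sqBox_of_collar (Ω := Ω) hδ0 hε₀ hδε hpa hε₀a hy
    have hyb := not_mem_sqBox_of_collar (Ω := Ω) hδ0 hε₀ hδε hpb hε₀b hy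
    rw [one_mul]
    exact ⟨fun hyΛ => (abs_hw_le_supDev (mem_regionW.2 ⟨hyΛ, hya, hyb⟩)).trans (supDev_le_twoPointNorm ε₀ δ),
      fun hyt => (abs_hb_le_supDev (mem_regionB.2 ⟨hyt, hya, hyb⟩)).trans (supDev_le_twoPointNorm ε₀ δ)⟩
  obtain ⟨d₁, hd₁, h₁⟩ := 𝓕.boundary_smallness_mesh hΩc' hΩo hΩb ⟨a, ha⟩ hM hadj (eventually_cuts hΩo hM ha hHF b)
    (eventually_prim hΩo hM ha hHF b) (eventually_holeFree hHF b) (eventually_odd hΩo hM ha hHF b)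
    (eventually_cst hΩo hM ha hHF b) hΛsub hε₀ hfar one_pos hN hapriori η hη
  obtain ⟨d₂, hd₂, h₂⟩ := 𝓕.boundary_smallness_hb_mesh hΩc' hΩo hΩb ⟨a, ha⟩ hM hadj (eventually_cuts hΩo hM ha hHF b)
    (eventually_prim hΩo hM ha hHF b) (eventually_holeFree hHF b) (eventually_odd hΩo hM ha hHF b)
    (eventually_cst hΩo hM ha hHF b) hΛsub hε₀ hfar one_pos hN hapriori η hη
  refine ⟨min d₁ d₂, by positivity, ?_⟩
  filter_upwards [h₁, h₂] with δ h₁ h₂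
  refine ⟨fun v hv hvd => ?_, fun f hf hfd => ?_⟩
  · have := h₁ v hv (hvd.trans (min_le_left _ _))
    rwa [one_mul] at this
  · have := h₂ f hf (hfd.trans (min_le_right _ _)); linarith

end Literature.Probability.LatticeModels
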